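/-
Origin: expansion seat `planner-pub-hodgecm-pv06-0`, handover 2026-08-18T03:54:42Z (`HOME/pub-hodgecm-pv06/lean/Pv06/PerL34/UnfoldVanish.lean`, md5 019430d5, 77 lines);
landed by the gen-5 packager in gate run 20 as `HodgeCM/PerL34/UnfoldVanish.lean` (import ^import Pv0[0-9]\.PerL34\.→import HodgeCM.PerL34. ×1).
-/
/-
Origin: pub-hodgecm formalisation cell (harness21, 2026), seat pub-hodgecm-pv06 (DAG-NODE PROVER #06),
node N23c glue (PerL v5 d912a121, Prop. 3.6 `prop:isol`, Step 2, tex ll. 423–426), joining the LANDED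
`HodgeCM.PerL34.PseudoEisenstein` (pv15, gate run 19: `N23a.unfolding_inner` = the displayed identity of
ll. 424–425) with `Pv06.PerL34.Vanishing` (pv06, handed over 03:53Z: the inference "for all f ⇒ vanishes
identically", l. 426).  Proposed place: `HodgeCM/PerL34/UnfoldVanish.lean` (module renames
`Pv06.PerL34.Vanishing` ↦ `HodgeCM.PerL34.Vanishing`, `Pv06.PerL34.UnfoldVanish` ↦ `HodgeCM.PerL34.UnfoldVanish`;
namespace `HodgeCM.PerL34.N23a`, next to pv15's theorems).  Imports: the landed package module + my
Vanishing file only.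

KIND: L1 glue (kernel; nothing posited, nothing cited).  G-R2-11-type edge closed BY NAME: the hypotheses
are pv15's `unfolding_inner` hypotheses verbatim plus `v ⟂ 𝓔` in pv15's function model, the conclusion is
the vanishing of the toric coefficient `h ↦ ∫_T β(t) conj χ(t) v(jT(t) h) dν(t)` (= "P_{T,χ̄}(R(h)v) = 0 for
all h ∈ U(W)(𝔸)", l. 426) — i.e. the consequence form `AnnihilationDatum.unfold` of
`HodgeCM/PerL34/Annihilation.lean` (pv06, run 19) read in pv15's model.
-/
import Summits.HodgeConjecture.HodgeCM.PerL34.PseudoEisenstein_3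
import Summits.HodgeConjecture.HodgeCM.PerL34.Vanishing

/-! PORT of `HodgeCM/PerL34/UnfoldVanish.lean` (HodgeCMPerL run 82) — verbatim mechanical port; provenance in the PORT header line. -/

open MeasureTheory Set

noncomputable section

namespace HodgeCM.PerL34.N23a

variable {G : Type*} [Group G] [TopologicalSpace G] [IsTopologicalGroup G] [T2Space G]
  [LocallyCompactSpace G] [MeasurableSpace G] [BorelSpace G]
  {T : Type*} [Group T] [TopologicalSpace T] [T2Space T] [MeasurableSpace T]
  [OpensMeasurableSpace T]

/-- **PerL v5 Prop 3.6 Step 2, ll. 423–426, kernel form in the function model.**  `G = U(W)(𝔸)` locally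
compact with a left Haar measure `μ` (left-invariant, finite on compacts, positive on nonempty opens),
`T = T(𝔸)` with `ν` finite on compacts, `jT : T → G`, `β` a continuous compactly supported cut-off and `χ`
a continuous character on `T`, `Γ = U(W)(L₀)` countable with fundamental domain `𝓕` (so `∫_𝓕 … dμ` is
`∫_{[U(W)]}`), `v` a continuous left-`Γ`-invariant function (a smooth vector of `L²([U(W)])`, l. 391/423).
IF `⟨E^χ_f, v⟩ = ∫_{[U(W)]} E^χ_f · conj v = 0` for every test function `f ∈ C_c(G)` (i.e. `v ⟂ 𝓔`), THEN the
continuous function `h ↦ P_{T,χ̄}(R(h)v) = ∫_T β(t) conj χ(t) v(jT(t) h) dν(t)` vanishes identically.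
Proof: pv15's `unfolding_inner` rewrites each pairing as `∫_G f(h) conj(P_{T,χ̄}(R(h)v)) dμ(h)`; pv06's
`Vanishing.toricCoeff_eq_zero_of_forall_test` (fundamental lemma + continuity of the coefficient) concludes. -/
theorem toricCoeff_eq_zero_of_orthogonal_Eis
    (μ : Measure G) [μ.IsMulLeftInvariant] [IsFiniteMeasureOnCompacts μ] [μ.IsOpenPosMeasure]
    (ν : Measure T) [IsFiniteMeasureOnCompacts ν]
    (jT : T →* G) (hjT : Continuous jT)
    (β : T → ℝ) (hβ : Continuous β) (hβs : HasCompactSupport β)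
    (χ : T → ℂ) (hχ : Continuous χ)
    (Γ : Subgroup G) [Countable Γ] (𝓕 : Set G) (h𝓕 : IsFundamentalDomain Γ 𝓕 μ)
    (v : G → ℂ) (hv : Continuous v) (hvinv : ∀ (γ : Γ) (y : G), v ((γ : G) * y) = v y)
    (horth : ∀ f : G → ℂ, Continuous f → HasCompactSupport f →
      ∫ y in 𝓕, Eis ν jT β χ Γ f y * (starRingEnd ℂ) (v y) ∂μ = 0) :
    ∀ h : G, ∫ t, ((β t : ℂ) * (starRingEnd ℂ) (χ t)) * v (jT t * h) ∂ν = 0 := by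
  -- the weight `w = β · conj χ` is continuous with compact support
  have hw : Continuous fun t => (β t : ℂ) * (starRingEnd ℂ) (χ t) :=
    (Complex.continuous_ofReal.comp hβ).mul (Complex.continuous_conj.comp hχ)
  have hws : HasCompactSupport fun t => (β t : ℂ) * (starRingEnd ℂ) (χ t) :=
    HasCompactSupport.intro hβs.isCompact fun t ht => by
      simp [image_eq_zero_of_notMem_tsupport ht]
  refine Vanishing.toricCoeff_eq_zero_of_forall_test μ ν jT hjT _ hw hws v hv ?_
  intro f hf hfs
  rw [← unfolding_inner μ ν jT hjT β hβ hβs χ hχ Γ 𝓕 h𝓕 f hf hfs v hv hvinv]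
  exact horth f hf hfs

/-- The same with `μ` a Haar measure (the three instances above by resolution). -/
theorem toricCoeff_eq_zero_of_orthogonal_Eis_haar
    (μ : Measure G) [μ.IsHaarMeasure] (ν : Measure T) [IsFiniteMeasureOnCompacts ν]
    (jT : T →* G) (hjT : Continuous jT)
    (β : T → ℝ) (hβ : Continuous β) (hβs : HasCompactSupport β)
    (χ : T → ℂ) (hχ : Continuous χ)
    (Γ : Subgroup G) [Countable Γ] (𝓕 : Set G) (h𝓕 : IsFundamentalDomain Γ 𝓕 μ)
    (v : G → ℂ) (hv : Continuous v) (hvinv : ∀ (γ : Γ) (y : G), v ((γ : G) * y) = v y)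
    (horth : ∀ f : G → ℂ, Continuous f → HasCompactSupport f →
      ∫ y in 𝓕, Eis ν jT β χ Γ f y * (starRingEnd ℂ) (v y) ∂μ = 0) :
    ∀ h : G, ∫ t, ((β t : ℂ) * (starRingEnd ℂ) (χ t)) * v (jT t * h) ∂ν = 0 :=
  toricCoeff_eq_zero_of_orthogonal_Eis μ ν jT hjT β hβ hβs χ hχ Γ 𝓕 h𝓕 v hv hvinv horth

end HodgeCM.PerL34.N23a

end
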